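import Summits.HubbardSuperconductivity.HubbardSuperconductivity.Theorems.ThermalWedgeTwSeededEnsembleEquivalenceROfColdDiffUniq
import Summits.HubbardSuperconductivity.HubbardSuperconductivity.Theorems.ThermalWedgeTwSeededEnsembleEquivalenceRDiffOfCompressibility
import Summits.HubbardSuperconductivity.HubbardSuperconductivity.Theorems.ThermalWedgeTwSeededEnsembleEquivalenceRUniqOfStrictConcavity

/-!
# Crux `TwSeededEnsembleEquivalenceR` (stmt-HubbardSuperconductivity-15581) FROM ITS TWO PHYSICS INPUTS IN
# ENGINE-FACING FORM: bounded compressibility (E_DIFF) and strict `s`-concavity (SCONC) at the cold slice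

Support file (`--supports stmt-HubbardSuperconductivity-15581`; sorry-free; no definition).

`twR_of_coldDiff_coldUniq` (…ROfColdDiffUniq.lean, line lead c1) closes the route decl
`ThermalWedge.TwSeededEnsembleEquivalenceR` from the two registered physics stubs DIFF (`stub_sourcedColdDiff`)
and UNIQ′ (`stub_sourcedColdUniq`). Composing with the two engine-facing bridges of this seat,

* `sdc_stub_sourcedColdDiff_of_compressibility` (…RDiffOfCompressibility.lean): E_DIFF ⟹ DIFF, where E_DIFF is the
  FINITE-VOLUME statement "at `β = e^{a/U}` the sourced torus pressure has symmetric second `μ`-differences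
  `≤ M t²` (`0 < t ≤ t₀`) uniformly in large `L`" (bounded compressibility = bounded Duhamel density–density
  response — what a convergent multiscale expansion one `μ`-derivative deep proves),
* `usc_stub_sourcedColdUniq_of_strictConcavity` (…RUniqOfStrictConcavity.lean): SCONC ⟹ UNIQ′, where SCONC is
  "every pointwise thermodynamic limit `q` of the cold sourced pressure is strictly concave in the squared source
  `s = h²` on `[0,(13g+1)²]`" (the BCS-variational content; elementary at `U = 0`),

gives `twR_of_compressibility_strictConcavity : E_DIFF → SCONC → TwSeededEnsembleEquivalenceR`: the crux, kernel-
checked, from the two statements in the form a constructive fermionic RG programme for the `d`-wave-sourced weakly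
repulsive Hubbard torus at `T = e^{−a/U}` would actually deliver. A planner promoting the physics of R to items may
file E_DIFF and SCONC (hypotheses 1 and 2 below, which elaborate as closed `Prop`s) and cite this theorem as the glue.
[folklore composition]
-/

set_option linter.dupNamespace false

namespace Summit.HubbardSuperconductivity.HubbardSuperconductivity.Theorems

open Matrix Set Literature.MathematicalPhysics.QuantumLattice
open Summit.HubbardSuperconductivity.HubbardSuperconductivity.Theses.ThermalWedge
open Summit.HubbardSuperconductivity.HubbardSuperconductivity.Theorems.TwSeededEnsembleEquivalenceR.ColdFloorLine
open scoped ComplexOrder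

noncomputable section

/-- **Crux R from bounded compressibility and strict `s`-concavity at the cold slice.**
E_DIFF → SCONC → `ThermalWedge.TwSeededEnsembleEquivalenceR`, by `twR_of_coldDiff_coldUniq` ∘
(`sdc_stub_sourcedColdDiff_of_compressibility`, `usc_stub_sourcedColdUniq_of_strictConcavity`).
[folklore composition] -/
theorem twR_of_compressibility_strictConcavity :
    (∀ (μ₁ μ₂ : ℝ), -4 < μ₁ → μ₁ < μ₂ → μ₂ < 0 → ∃ a₀ : ℝ, 0 < a₀ ∧ ∀ a ∈ Set.Ioc (0 : ℝ) a₀,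
      ∃ K' U₀ : ℝ, 0 < K' ∧ 0 < U₀ ∧ ∀ U ∈ Set.Ioc (0 : ℝ) U₀, ∀ g ∈ Set.Icc (K' * U) (1 / 10),
        ∀ μ ∈ Set.Ioo μ₁ μ₂, ∀ h ∈ Set.Icc (-(13 * g + 1)) (13 * g + 1),
          ∃ M t₀ : ℝ, 0 < t₀ ∧ ∃ L₀ : ℕ, ∀ (L : ℕ) [NeZero L], L₀ ≤ L → ∀ t : ℝ, 0 < t → t ≤ t₀ →
            Real.log (Matrix.partitionFn (Real.exp (a / U)) (dWaveSourceTorus L U (μ + t) h)).re /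
                  (Real.exp (a / U) * (L : ℝ) ^ 2) +
                Real.log (Matrix.partitionFn (Real.exp (a / U)) (dWaveSourceTorus L U (μ - t) h)).re /
                  (Real.exp (a / U) * (L : ℝ) ^ 2) -
              2 * (Real.log (Matrix.partitionFn (Real.exp (a / U)) (dWaveSourceTorus L U μ h)).re /
                  (Real.exp (a / U) * (L : ℝ) ^ 2)) ≤ M * t ^ 2) →
    (∀ (μ₁ μ₂ : ℝ), -4 < μ₁ → μ₁ < μ₂ → μ₂ < 0 → ∃ a₁ : ℝ, 0 < a₁ ∧ ∀ a ∈ Set.Ioc (0 : ℝ) a₁,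
      ∃ K' U₀ : ℝ, 0 < K' ∧ 0 < U₀ ∧ ∀ U ∈ Set.Ioc (0 : ℝ) U₀, ∀ g ∈ Set.Icc (K' * U) (1 / 10),
        ∀ q : ℝ → ℝ → ℝ,
          (∀ μ ∈ Set.Icc μ₁ μ₂, ∀ h ∈ Set.Icc (-(13 * g + 1)) (13 * g + 1), ∀ κ : ℝ, 0 < κ →
            ∃ L₀ : ℕ, ∀ (L : ℕ) [NeZero L], L₀ ≤ L →
              |Real.log (Matrix.partitionFn (Real.exp (a / U)) (dWaveSourceTorus L U μ h)).re /
                  (Real.exp (a / U) * (L : ℝ) ^ 2) - q μ h| ≤ κ) →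
          ∀ μ ∈ Set.Ioo μ₁ μ₂,
            StrictConcaveOn ℝ (Set.Icc (0 : ℝ) ((13 * g + 1) ^ 2)) (fun s : ℝ => q μ (Real.sqrt s))) →
    TwSeededEnsembleEquivalenceR := fun hE hS =>
  twR_of_coldDiff_coldUniq (sdc_stub_sourcedColdDiff_of_compressibility hE)
    (usc_stub_sourcedColdUniq_of_strictConcavity hS)

end

end Summit.HubbardSuperconductivity.HubbardSuperconductivity.Theorems
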